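import Summits.ResolutionOfSingularities.ResolutionOfSingularities.Theorems.WeightedInvariantWeightedConstructionSingularLocusClosed
import Summits.ResolutionOfSingularities.ResolutionOfSingularities.Theorems.WeightedInvariantWeightedConstructionSingularLocusComap
import Mathlib.AlgebraicGeometry.Morphisms.Smooth
import Mathlib.AlgebraicGeometry.Morphisms.UniversallyOpen
import HarnessLib

/-!
# Crux `WeightedConstruction`, line `pointwise-lexmax-hull`: toolkit for stub `stub_hullUsc`

Route `ResolutionOfSingularities/WeightedInvariant`, crux `WeightedConstruction`
(stmt-ResolutionOfSingularities-0571), line `pointwise-lexmax-hull`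
(`Cruxes/WeightedConstruction/Lines/pointwise_lexmax_hull.lean`), registered stub

  `stub_hullUsc : ∀ p, p.Prime → ∀ R : LexmaxHullRule p, R.USC ∧ R.HullComap ∧ R.HullBaseChange`.

[OURS · L1 w43] The rule's rating is the **hull** `hull y` = the GREATEST value `gen η` over the
singular generisations `η ⤳ y` of a singular point `y` (field `hull_isGreatest` of `LexmaxHullRule`).
Everything in this file is the STRUCTURAL part of the stub, valid for every function `hull` pinned by
that `IsGreatest` property — no property of `plex`/`gen` beyond the stated hypotheses is used:

* `genHull_mono` — `hull` is specialisation-monotone on the singular locus (for free);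
  `gen_le_genHull`, `exists_genHull_eq` — `gen ≤ hull`, and `hull y = gen η` for some singular `η ⤳ y`.
* `genHull_superlevel_eq`, `isClosed_genHull_superlevel`, `isClosed_genHull_superlevel_of_finite` —
  `(usc)`: a superlevel set `{y ∈ Sing | γ ≤ hull y}` is `Sing ∩ ⋃_{η₀ ∈ F} closure {η₀}` for any finite
  family `F` of singular points dominating it, hence closed; in particular `(usc)` for ALL `γ` follows
  from ONE finite `gen`-dominating family (`∀ η ∈ Sing, ∃ η₀ ∈ F, η₀ ⤳ η ∧ gen η ≤ gen η₀` — the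
  constructibility residue of the stub, to be supplied by the rule).
* `genHull_eq_of_generalizingMap`, `genHull_eq_of_flat`, `flat_of_isPullback_Spec_field`,
  `genHull_eq_of_isPullback` — `(i)`: along a continuous GENERALIZING map `g` (going-down; every flat,
  in particular every smooth morphism and every ground-field base change, `Flat.generalizingMap`)
  under which the singular loci correspond and `gen` is invariant at singular points, the hulls agree:
  the two sets of which the hulls are the greatest elements coincide.
* `isClosed_superlevel_genHull_xSing`, `genHull_comap_eq_of_smooth`,
  `genHull_comap_eq_of_isPullback_perfectField` — the same three statements with the singular locus
  `XSing X y :↔ ∃ x : X.subscheme, X.subschemeι x = y ∧ ¬ IsRegularLocalRing 𝒪_{X.subscheme,x}` of the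
  skeleton, using the landed `stub_isClosed_singularLocus`, `xSing_comap_iff_of_smooth`,
  `xSing_comap_iff_of_isPullback_perfectField`.

Consequence for the line (census in L/res-L1-w43-stub-2/NOTES.md): `stub_hullUsc` reduces to three
`gen`-level statements about the rule — `GenFinite` (finite dominating family), `GenComap`,
`GenBaseChange` (invariance of `gen` at singular points) — and no longer mentions `hull`.
No new mathematics is claimed; NOT a statement of the manuscript under review.
-/

set_option linter.dupNamespace false -- mandated namespace of this single-conjunct summit

open CategoryTheory CategoryTheory.Limits AlgebraicGeometry TopologicalSpace Topology

namespace Summit.ResolutionOfSingularities.ResolutionOfSingularities.Theorems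

universe u v w

section Topology

variable {Y : Type v} [TopologicalSpace Y] {α : Type w}

/-- **The hull is specialisation-monotone on the singular locus.** If `hull y` is the greatest `gen η`
over the singular generisations `η ⤳ y` (for every singular `y`), then `y' ⤳ y` with `y, y'` singular
gives `hull y' ≤ hull y`: every singular generisation of `y'` is one of `y`. [folklore] -/
theorem genHull_mono [Preorder α] {S : Y → Prop} {gen hull : Y → α}
    (hhull : ∀ y, S y → IsGreatest {π | ∃ η : Y, η ⤳ y ∧ S η ∧ π = gen η} (hull y))
    {y y' : Y} (hy : S y) (hy' : S y') (h : y' ⤳ y) : hull y' ≤ hull y :=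
  (hhull y' hy').mono (hhull y hy) fun _ ⟨η, hη, hSη, hπ⟩ => ⟨η, hη.trans h, hSη, hπ⟩

/-- `gen y ≤ hull y` at a singular point (`y ⤳ y`). [folklore] -/
theorem gen_le_genHull [Preorder α] {S : Y → Prop} {gen hull : Y → α}
    (hhull : ∀ y, S y → IsGreatest {π | ∃ η : Y, η ⤳ y ∧ S η ∧ π = gen η} (hull y))
    {y : Y} (hy : S y) : gen y ≤ hull y :=
  (hhull y hy).2 ⟨y, specializes_rfl, hy, rfl⟩

/-- The hull value is attained: `hull y = gen η` for some singular generisation `η ⤳ y`. [folklore] -/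
theorem exists_genHull_eq [Preorder α] {S : Y → Prop} {gen hull : Y → α}
    (hhull : ∀ y, S y → IsGreatest {π | ∃ η : Y, η ⤳ y ∧ S η ∧ π = gen η} (hull y))
    {y : Y} (hy : S y) : ∃ η : Y, η ⤳ y ∧ S η ∧ hull y = gen η :=
  (hhull y hy).1

/-- **Superlevel sets of the hull.** If a family `F` of singular points with `γ ≤ gen η₀` (`η₀ ∈ F`)
dominates the superlevel set `{y ∈ Sing | γ ≤ hull y}` (every such `y` specialises from some `η₀ ∈ F`),
then that superlevel set is exactly `Sing ∩ ⋃_{η₀ ∈ F} closure {η₀}`. [folklore] -/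
theorem genHull_superlevel_eq [Preorder α] {S : Y → Prop} {gen hull : Y → α}
    (hhull : ∀ y, S y → IsGreatest {π | ∃ η : Y, η ⤳ y ∧ S η ∧ π = gen η} (hull y))
    (γ : α) {F : Set Y} (hF : ∀ η₀ ∈ F, S η₀ ∧ γ ≤ gen η₀)
    (hdom : ∀ y, S y → γ ≤ hull y → ∃ η₀ ∈ F, η₀ ⤳ y) :
    {y | S y ∧ γ ≤ hull y} = {y | S y} ∩ ⋃ η₀ ∈ F, closure {η₀} := by
  ext y
  simp only [Set.mem_setOf_eq, Set.mem_inter_iff, Set.mem_iUnion, exists_prop]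
  constructor
  · rintro ⟨hy, hγ⟩
    obtain ⟨η₀, hη₀F, hη₀y⟩ := hdom y hy hγ
    exact ⟨hy, η₀, hη₀F, specializes_iff_mem_closure.mp hη₀y⟩
  · rintro ⟨hy, η₀, hη₀F, hyη₀⟩
    have hη₀y : η₀ ⤳ y := specializes_iff_mem_closure.mpr hyη₀
    exact ⟨hy, (hF η₀ hη₀F).2.trans ((hhull y hy).2 ⟨η₀, hη₀y, (hF η₀ hη₀F).1, rfl⟩)⟩

/-- **`(usc)` from a finite dominating family.** With the singular locus closed and a FINITE family as
in `genHull_superlevel_eq`, the superlevel set `{y ∈ Sing | γ ≤ hull y}` is closed (a finite union of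
closures of points, cut with a closed set). [folklore] -/
theorem isClosed_genHull_superlevel [Preorder α] {S : Y → Prop} {gen hull : Y → α}
    (hhull : ∀ y, S y → IsGreatest {π | ∃ η : Y, η ⤳ y ∧ S η ∧ π = gen η} (hull y))
    (hS : IsClosed {y | S y}) (γ : α) {F : Set Y} (hfin : F.Finite)
    (hF : ∀ η₀ ∈ F, S η₀ ∧ γ ≤ gen η₀) (hdom : ∀ y, S y → γ ≤ hull y → ∃ η₀ ∈ F, η₀ ⤳ y) :
    IsClosed {y | S y ∧ γ ≤ hull y} := by
  rw [genHull_superlevel_eq hhull γ hF hdom]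
  exact hS.inter (hfin.isClosed_biUnion fun _ _ => isClosed_closure)

/-- **`(usc)` for every threshold from ONE finite `gen`-dominating family.** If the singular locus is
closed and finitely many singular points `F` dominate `gen` (every singular `η` specialises from some
`η₀ ∈ F` with `gen η ≤ gen η₀` — e.g. the generic points of a finite stratification on whose strata the
pointwise invariant is generically constant), then ALL superlevel sets of the hull in the singular
locus are closed. [folklore] -/
theorem isClosed_genHull_superlevel_of_finite [Preorder α] {S : Y → Prop} {gen hull : Y → α}
    (hhull : ∀ y, S y → IsGreatest {π | ∃ η : Y, η ⤳ y ∧ S η ∧ π = gen η} (hull y))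
    (hS : IsClosed {y | S y}) {F : Set Y} (hfin : F.Finite) (hFS : ∀ η₀ ∈ F, S η₀)
    (hdom : ∀ η, S η → ∃ η₀ ∈ F, η₀ ⤳ η ∧ gen η ≤ gen η₀) (γ : α) :
    IsClosed {y | S y ∧ γ ≤ hull y} := by
  refine isClosed_genHull_superlevel hhull hS γ (hfin.subset (Set.sep_subset F fun η₀ => γ ≤ gen η₀))
    (fun η₀ hη₀ => ⟨hFS η₀ hη₀.1, hη₀.2⟩) fun y hy hγ => ?_
  obtain ⟨η, hηy, hSη, hηeq⟩ := exists_genHull_eq hhull hy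
  obtain ⟨η₀, hη₀F, hη₀η, hle⟩ := hdom η hSη
  exact ⟨η₀, ⟨hη₀F, (hγ.trans_eq hηeq).trans hle⟩, hη₀η.trans hηy⟩

/-- **`(i)`: hulls agree along a continuous generalizing map.** Let `g : Y₁ → Y` be continuous and
GENERALIZING (generisations of `g y₁` lift to generisations of `y₁` — going-down), let the singular loci
correspond (`S₁ = g⁻¹ S`) and let `gen` be invariant at singular points. Then the set of values
`gen₁ η₁` over singular `η₁ ⤳ y₁` equals the set of values `gen η` over singular `η ⤳ g y₁`, so their
greatest elements — the hulls — agree. [folklore] -/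
theorem genHull_eq_of_generalizingMap [PartialOrder α] {Y₁ : Type u} [TopologicalSpace Y₁]
    {g : Y₁ → Y} (hg : Continuous g) (hgen : GeneralizingMap g)
    {S : Y → Prop} {S₁ : Y₁ → Prop} (hS : ∀ y₁, S₁ y₁ ↔ S (g y₁))
    {gen hull : Y → α} {gen₁ hull₁ : Y₁ → α}
    (hhull : ∀ y, S y → IsGreatest {π | ∃ η : Y, η ⤳ y ∧ S η ∧ π = gen η} (hull y))
    (hhull₁ : ∀ y₁, S₁ y₁ → IsGreatest {π | ∃ η₁ : Y₁, η₁ ⤳ y₁ ∧ S₁ η₁ ∧ π = gen₁ η₁} (hull₁ y₁))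
    (hgg : ∀ η₁, S (g η₁) → gen₁ η₁ = gen (g η₁))
    {y₁ : Y₁} (hy : S (g y₁)) : hull₁ y₁ = hull (g y₁) := by
  have hset : {π | ∃ η₁ : Y₁, η₁ ⤳ y₁ ∧ S₁ η₁ ∧ π = gen₁ η₁} =
      {π | ∃ η : Y, η ⤳ g y₁ ∧ S η ∧ π = gen η} := by
    ext π
    constructor
    · rintro ⟨η₁, hη₁, hS₁, rfl⟩
      have hSη : S (g η₁) := (hS η₁).mp hS₁
      exact ⟨g η₁, hη₁.map hg, hSη, hgg η₁ hSη⟩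
    · rintro ⟨η, hη, hSη, rfl⟩
      obtain ⟨η₁, hη₁, rfl⟩ := hgen hη
      exact ⟨η₁, hη₁, (hS η₁).mpr hSη, (hgg η₁ hSη).symm⟩
  have h₁ := hhull₁ y₁ ((hS y₁).mpr hy)
  rw [hset] at h₁
  exact h₁.unique (hhull (g y₁) hy)

end Topology

/-! ## Scheme-level forms: flat morphisms are generalizing -/

/-- **`(i)` along a flat morphism of schemes** (in particular a smooth one): `Flat.generalizingMap`
feeds `genHull_eq_of_generalizingMap`. [folklore] -/
theorem genHull_eq_of_flat {α : Type w} [PartialOrder α] {Y Y₁ : Scheme.{u}} (g : Y₁ ⟶ Y) [Flat g]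
    {S : Y → Prop} {S₁ : Y₁ → Prop} (hS : ∀ y₁, S₁ y₁ ↔ S (g y₁))
    {gen hull : Y → α} {gen₁ hull₁ : Y₁ → α}
    (hhull : ∀ y, S y → IsGreatest {π | ∃ η : Y, η ⤳ y ∧ S η ∧ π = gen η} (hull y))
    (hhull₁ : ∀ y₁, S₁ y₁ → IsGreatest {π | ∃ η₁ : Y₁, η₁ ⤳ y₁ ∧ S₁ η₁ ∧ π = gen₁ η₁} (hull₁ y₁))
    (hgg : ∀ η₁, S (g η₁) → gen₁ η₁ = gen (g η₁))
    {y₁ : Y₁} (hy : S (g y₁)) : hull₁ y₁ = hull (g y₁) :=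
  genHull_eq_of_generalizingMap g.continuous (Flat.generalizingMap g) hS hhull hhull₁ hgg hy

/-- **A base change of the structure morphism to a field is flat**: in a cartesian square
`pr : YK → Y`, `fK : YK → T`, `f : Y → Spec k`, `i : T → Spec k` with `k` a field, the projection `pr`
is flat — `i` is flat (everything is flat over a field) and flatness is stable under base change.
[folklore] -/
theorem flat_of_isPullback_Spec_field {k : Type u} [Field k] {Y YK T : Scheme.{u}}
    (f : Y ⟶ Spec (.of k)) (fK : YK ⟶ T) (i : T ⟶ Spec (.of k)) (pr : YK ⟶ Y)
    (hpb : IsPullback pr fK f i) : Flat pr := by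
  haveI : Subsingleton ↥(Spec (CommRingCat.of k)) :=
    inferInstanceAs (Subsingleton (PrimeSpectrum k))
  haveI : Flat i := inferInstance
  exact MorphismProperty.IsStableUnderBaseChange.of_isPullback (P := @Flat) hpb.flip ‹Flat i›

/-- **`(i)` along a ground-field base change**: in a cartesian square over `Spec k` (`k` a field) the
projection `pr : YK → Y` is flat, hence generalizing, and `genHull_eq_of_flat` applies. [folklore] -/
theorem genHull_eq_of_isPullback {α : Type w} [PartialOrder α] {k : Type u} [Field k]
    {Y YK T : Scheme.{u}} (f : Y ⟶ Spec (.of k)) (fK : YK ⟶ T) (i : T ⟶ Spec (.of k)) (pr : YK ⟶ Y)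
    (hpb : IsPullback pr fK f i)
    {S : Y → Prop} {S₁ : YK → Prop} (hS : ∀ y₁, S₁ y₁ ↔ S (pr y₁))
    {gen hull : Y → α} {gen₁ hull₁ : YK → α}
    (hhull : ∀ y, S y → IsGreatest {π | ∃ η : Y, η ⤳ y ∧ S η ∧ π = gen η} (hull y))
    (hhull₁ : ∀ y₁, S₁ y₁ → IsGreatest {π | ∃ η₁ : YK, η₁ ⤳ y₁ ∧ S₁ η₁ ∧ π = gen₁ η₁} (hull₁ y₁))
    (hgg : ∀ η₁, S (pr η₁) → gen₁ η₁ = gen (pr η₁))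
    {y₁ : YK} (hy : S (pr y₁)) : hull₁ y₁ = hull (pr y₁) :=
  haveI := flat_of_isPullback_Spec_field f fK i pr hpb
  genHull_eq_of_flat pr hS hhull hhull₁ hgg hy

/-! ## The three statements of the stub, with the skeleton's singular locus `XSing` -/

/-- **`(usc)` for `XSing`.** For `Y` locally of finite type over a field and an ideal sheaf `X`, the
singular locus `{y | ∃ x : X.subscheme over y, 𝒪_{X.subscheme,x} not regular}` is closed
(`stub_isClosed_singularLocus`); so a hull over it with a finite `gen`-dominating family of singular
points has closed superlevel sets — the shape of `LexmaxHullRule.USC`. [folklore] -/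
theorem isClosed_superlevel_genHull_xSing {α : Type w} [Preorder α] ⦃k : Type⦄ [Field k]
    ⦃Y : Scheme.{0}⦄ (f : Y ⟶ Spec (.of k)) [LocallyOfFiniteType f] (X : Y.IdealSheafData)
    {gen hull : Y → α}
    (hhull : ∀ y : Y, (∃ x : X.subscheme, X.subschemeι x = y ∧
        ¬ IsRegularLocalRing (X.subscheme.presheaf.stalk x)) →
      IsGreatest {π | ∃ η : Y, η ⤳ y ∧ (∃ x : X.subscheme, X.subschemeι x = η ∧
        ¬ IsRegularLocalRing (X.subscheme.presheaf.stalk x)) ∧ π = gen η} (hull y))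
    {F : Set Y} (hfin : F.Finite)
    (hFS : ∀ η₀ ∈ F, ∃ x : X.subscheme, X.subschemeι x = η₀ ∧
      ¬ IsRegularLocalRing (X.subscheme.presheaf.stalk x))
    (hdom : ∀ η : Y, (∃ x : X.subscheme, X.subschemeι x = η ∧
        ¬ IsRegularLocalRing (X.subscheme.presheaf.stalk x)) →
      ∃ η₀ ∈ F, η₀ ⤳ η ∧ gen η ≤ gen η₀)
    (γ : α) :
    IsClosed {y : Y | (∃ x : X.subscheme, X.subschemeι x = y ∧
      ¬ IsRegularLocalRing (X.subscheme.presheaf.stalk x)) ∧ γ ≤ hull y} :=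
  isClosed_genHull_superlevel_of_finite hhull (stub_isClosed_singularLocus f X) hfin hFS hdom γ

/-- **`(i)` for `XSing`, smooth morphisms.** For a smooth `k`-morphism `g : Y₁ → Y` of schemes locally of
finite type over a field, the singular loci of `X.comap g` and `X` correspond
(`xSing_comap_iff_of_smooth`), `g` is flat hence generalizing; so if `gen` is invariant at singular
points then so is the hull — the shape of `LexmaxHullRule.HullComap`. [folklore] -/
theorem genHull_comap_eq_of_smooth {α : Type w} [PartialOrder α] ⦃k : Type⦄ [Field k]
    ⦃Y Y₁ : Scheme.{0}⦄ (f : Y ⟶ Spec (.of k)) [LocallyOfFiniteType f] (f₁ : Y₁ ⟶ Spec (.of k))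
    [LocallyOfFiniteType f₁] (g : Y₁ ⟶ Y) [Smooth g] (hg : g ≫ f = f₁) (X : Y.IdealSheafData)
    {gen hull : Y → α} {gen₁ hull₁ : Y₁ → α}
    (hhull : ∀ y : Y, (∃ x : X.subscheme, X.subschemeι x = y ∧
        ¬ IsRegularLocalRing (X.subscheme.presheaf.stalk x)) →
      IsGreatest {π | ∃ η : Y, η ⤳ y ∧ (∃ x : X.subscheme, X.subschemeι x = η ∧
        ¬ IsRegularLocalRing (X.subscheme.presheaf.stalk x)) ∧ π = gen η} (hull y))
    (hhull₁ : ∀ y₁ : Y₁, (∃ x₁ : (X.comap g).subscheme, (X.comap g).subschemeι x₁ = y₁ ∧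
        ¬ IsRegularLocalRing ((X.comap g).subscheme.presheaf.stalk x₁)) →
      IsGreatest {π | ∃ η₁ : Y₁, η₁ ⤳ y₁ ∧ (∃ x₁ : (X.comap g).subscheme,
        (X.comap g).subschemeι x₁ = η₁ ∧
          ¬ IsRegularLocalRing ((X.comap g).subscheme.presheaf.stalk x₁)) ∧ π = gen₁ η₁} (hull₁ y₁))
    (hgg : ∀ η₁ : Y₁, (∃ x : X.subscheme, X.subschemeι x = g η₁ ∧
        ¬ IsRegularLocalRing (X.subscheme.presheaf.stalk x)) → gen₁ η₁ = gen (g η₁))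
    (y₁ : Y₁) (hy : ∃ x : X.subscheme, X.subschemeι x = g y₁ ∧
      ¬ IsRegularLocalRing (X.subscheme.presheaf.stalk x)) :
    hull₁ y₁ = hull (g y₁) :=
  genHull_eq_of_flat g (fun y₁ => xSing_comap_iff_of_smooth f f₁ g hg X y₁) hhull hhull₁ hgg hy

/-- **`(i)` for `XSing`, perfect ground-field extensions.** For a cartesian square
`pr : YK = Y ×_k K → Y` over `φ : k → K` with `k ⊆ K` perfect and `Y` locally of finite type over `k`,
the singular loci of `X.comap pr` and `X` correspond (`xSing_comap_iff_of_isPullback_perfectField`) and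
`pr` is flat hence generalizing; so if `gen` is invariant at singular points then so is the hull — the
shape of `LexmaxHullRule.HullBaseChange`. [folklore] -/
theorem genHull_comap_eq_of_isPullback_perfectField {α : Type w} [PartialOrder α] ⦃k : Type⦄
    [Field k] [PerfectField k] ⦃K : Type⦄ [Field K] [PerfectField K] (φ : k →+* K)
    ⦃Y YK : Scheme.{0}⦄ (f : Y ⟶ Spec (.of k)) [LocallyOfFiniteType f] (fK : YK ⟶ Spec (.of K))
    (pr : YK ⟶ Y) (hpb : IsPullback pr fK f (Spec.map (CommRingCat.ofHom φ))) (X : Y.IdealSheafData)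
    {gen hull : Y → α} {gen₁ hull₁ : YK → α}
    (hhull : ∀ y : Y, (∃ x : X.subscheme, X.subschemeι x = y ∧
        ¬ IsRegularLocalRing (X.subscheme.presheaf.stalk x)) →
      IsGreatest {π | ∃ η : Y, η ⤳ y ∧ (∃ x : X.subscheme, X.subschemeι x = η ∧
        ¬ IsRegularLocalRing (X.subscheme.presheaf.stalk x)) ∧ π = gen η} (hull y))
    (hhull₁ : ∀ y₁ : YK, (∃ x₁ : (X.comap pr).subscheme, (X.comap pr).subschemeι x₁ = y₁ ∧
        ¬ IsRegularLocalRing ((X.comap pr).subscheme.presheaf.stalk x₁)) →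
      IsGreatest {π | ∃ η₁ : YK, η₁ ⤳ y₁ ∧ (∃ x₁ : (X.comap pr).subscheme,
        (X.comap pr).subschemeι x₁ = η₁ ∧
          ¬ IsRegularLocalRing ((X.comap pr).subscheme.presheaf.stalk x₁)) ∧ π = gen₁ η₁} (hull₁ y₁))
    (hgg : ∀ η₁ : YK, (∃ x : X.subscheme, X.subschemeι x = pr η₁ ∧
        ¬ IsRegularLocalRing (X.subscheme.presheaf.stalk x)) → gen₁ η₁ = gen (pr η₁))
    (y₁ : YK) (hy : ∃ x : X.subscheme, X.subschemeι x = pr y₁ ∧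
      ¬ IsRegularLocalRing (X.subscheme.presheaf.stalk x)) :
    hull₁ y₁ = hull (pr y₁) :=
  genHull_eq_of_isPullback f fK (Spec.map (CommRingCat.ofHom φ)) pr hpb
    (fun y => xSing_comap_iff_of_isPullback_perfectField φ f fK pr hpb X y) hhull hhull₁ hgg hy

end Summit.ResolutionOfSingularities.ResolutionOfSingularities.Theorems
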